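import Summits.BirchSwinnertonDyer.BirchSwinnertonDyer.Theorems.PAdicOrderV2PadicBSDrankOrderEqCorankOdd
import Literature.NumberTheory.EllipticCurves.SelmerCorankControlProofs
import Literature.NumberTheory.EllipticCurves.SelmerCorankHolds

/-!
# BirchSwinnertonDyer / PAdicOrderV2 — crux `PAdicOrderPadicBSDrankR2` (stmt-0490), line `Sketch`:
# the crux at a point is EXACTLY three open legs, modulo two PRINTED theorems (helper, `--supports`)

For `E/ℚ` (globally minimal `W`), a prime `p`, a cusp form `f`, `L_p = padicLFunction f (unitRoot W p)`,
the cyclotomic `κ` with topological generator `γ`, a dual datum `D` with Iwasawa module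
`X = D.X = X(E/ℚ_∞)` (`T = γ - 1`), and the height-one prime `𝔭_T = (T)` of `Λ = ℤ_p⟦T⟧`, there is a
chain of inequalities in which every link but the outer equality is a theorem (in print or in the tree):

  `rank E(ℚ) ≤ corank_{ℤ_p} Sel_{p^∞}(E/ℚ) = rank_{ℤ_p} X/TX ≤ ℓ_{𝔭_T}(X) ≤ ord_{T=0} L_p(E,T)`

(Kummer, proved: `selmerCorank_eq_mordellWeilRank_add_holds`; Mazur control = (CT), printed;
the local structure inequality at `(T)`, proved: `coinvariantsRank_le_lengthAt_primeT`; Kato's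
divisibility `char_Λ X ∋ g`, `ι g = p^n L_p`, Thm 17.4 (1)–(2) = (KD), printed, through the proved
`lengthAt_primeT_le_order`). The crux at the point, `ord_{T=0} L_p = rank E(ℚ)`, is therefore
EQUIVALENT to the conjunction of the three equalities, which are, link by link:

* (Ш)     `corank_{ℤ_p} Ш(E/ℚ)[p^∞] = 0`                                — item stmt-0132 at the point;
* (SS)    `rank_{ℤ_p} X/TX = ℓ_{𝔭_T}(X)`, i.e. `T · X_{(T)} = 0`, i.e. Greenberg's Conj. 1.12 at `T`
          (integral spelling `p^k T² x = 0 ⇒ p^{k'} T x = 0`)           — item stmt-0509 at the point;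
* (MC_T)  `ℓ_{𝔭_T}(X) = ord_{T=0} L_p(E,T)`: the exponent of `(T)` in `char_Λ X(E/ℚ_∞)` equals the
          order of vanishing of `L_p(E,T)` — the main conjecture AT THE PRIME `(T)` only, strictly
          weaker than item stmt-15426 (`char_Λ X = (L_p)` in `Λ ⊗ ℚ_p`, all height-one primes `∌ p`).

Theorems:
* `padicBSDrank_exists_smul_X_smul_eq_zero_of_lengthAt_eq` — (SS) from the length equality
  (generator-free form of the landed `padicBSDrank_exists_smul_X_smul_eq_zero_of_order_eq`).
* `padicBSDrank_lengthAt_eq_coinvariantsRank_of_semisimple` — conversely `T`-semisimplicity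
  (`ker T² = ker T` on `ℚ_p ⊗ X`) gives `ℓ_{𝔭_T}(X) = rank_{ℤ_p} X/TX` (in `ℕ∞`).
* `padicBSDrank_eq_at_point_iff_three_legs` — THE EQUIVALENCE at a point carrying (KD) and (CT).
* `padicBSDrank_mainConjectureAtT_of_crux` — globally: the crux ∧ Kato's divisibility (tree fact
  `kato_divisibility`, odd `p`) ∧ Mazur control ⇒ (MC_T) for every variable-matched cyclotomic datum
  of every modular curve at every odd good ordinary prime: the main conjecture at `(T)` is a NECESSARY
  input of the crux, as semisimplicity (`padicBSDrank_semisimple_of_crux`, Lossless) and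
  `Ш[p^∞]`-cotorsion (`Negative/ShaCotorsionOfCrux.lean`) are.
-/

-- D-0017: single-problem summit, so `Summit.BirchSwinnertonDyer.BirchSwinnertonDyer.…` repeats a
-- namespace BY DESIGN.
set_option linter.dupNamespace false

noncomputable section

universe u

namespace Summit.BirchSwinnertonDyer.BirchSwinnertonDyer.Theorems

open scoped MatrixGroups ModularForm TensorProduct
open CongruenceSubgroup Literature.NumberTheory.EllipticCurves
  Literature.NumberTheory.EllipticCurves.ModularForms
  Literature.NumberTheory.EllipticCurves.IwasawaAlgebra
open Summit.BirchSwinnertonDyer.BirchSwinnertonDyer.Theses.PAdicOrderV2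

/-! ## The commutative algebra at `𝔭_T = (T)` -/

/-- **(SS) from the length equality.** For a finitely generated torsion `Λ`-module `M` with
`ℓ_{(T)}(M) = rank_{ℤ_p} M/TM`, every `T m` is killed by a power series with non-zero constant term
(`T · M_{(T)} = 0`): `ℓ(M) = ℓ(TM) + ℓ(M/TM)`, `ℓ(M/TM) ≥ rank M/TM`, all finite, so `ℓ(TM) = 0`.
[cite: GreenbergLNM1716, §1 p. 65 (after Conj. 1.12)] -/
theorem padicBSDrank_exists_smul_X_smul_eq_zero_of_lengthAt_eq (p : ℕ) [Fact p.Prime]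
    {M : Type u} [AddCommGroup M] [Module (IwasawaAlgebra p) M]
    [Module.Finite (IwasawaAlgebra p) M] (hM : Module.IsTorsion (IwasawaAlgebra p) M)
    (hℓM : Module.lengthAt (IwasawaAlgebra p) M (primeT p) = (coinvariantsRank p M : ℕ∞)) (m : M) :
    ∃ u : IwasawaAlgebra p, PowerSeries.constantCoeff u ≠ 0 ∧
      u • (PowerSeries.X : IwasawaAlgebra p) • m = 0 := by
  have h𝔭 : (primeT p).asIdeal = Ideal.span {(PowerSeries.X : IwasawaAlgebra p)} := rfl
  have hfin : Module.lengthAt (IwasawaAlgebra p) M (primeT p) ≠ ⊤ := lengthAt_primeT_ne_top M hM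
  -- `ℓ(M/TM) ≥ rank M/TM`
  letI : Module ℤ_[p] (coinvariants p M) :=
    Module.compHom _ (algebraMap ℤ_[p] (IwasawaAlgebra p))
  haveI : IsScalarTower ℤ_[p] (IwasawaAlgebra p) (coinvariants p M) :=
    IsScalarTower.of_compHom ℤ_[p] _ _
  have hT : ∀ q : coinvariants p M, (PowerSeries.X : IwasawaAlgebra p) • q = 0 := by
    intro q
    induction q using Submodule.Quotient.induction_on with
    | H x => rw [← Submodule.Quotient.mk_smul]; exact coinvariants_mk_X_smul p M x
  have hℓQ : (coinvariantsRank p M : ℕ∞) ≤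
      Module.lengthAt (IwasawaAlgebra p) (coinvariants p M) (primeT p) := by
    rw [lengthAt_eq_toENat_rank_of_X_smul_eq_zero p hT (primeT p) h𝔭,
      coinvariantsRank_eq_finrank_int]
    exact ENat.coe_toNat_le_self _
  -- additivity on `0 → TM → M → M/TM → 0` gives `ℓ(TM) = 0`
  have hadd := Module.lengthAt_eq_add_of_exact _ _ (Submodule.subtype_injective _)
    (Submodule.mkQ_surjective _)
    (LinearMap.exact_subtype_mkQ (Ideal.span {(PowerSeries.X : IwasawaAlgebra p)} •
      (⊤ : Submodule (IwasawaAlgebra p) M))) (primeT p)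
  have hQfin : Module.lengthAt (IwasawaAlgebra p) (coinvariants p M) (primeT p) ≠ ⊤ := by
    intro htop
    apply hfin
    rw [hadd]
    change _ + Module.lengthAt (IwasawaAlgebra p) (coinvariants p M) (primeT p) = ⊤
    rw [htop, add_top]
  have h0 : Module.lengthAt (IwasawaAlgebra p)
      ↥(Ideal.span {(PowerSeries.X : IwasawaAlgebra p)} • (⊤ : Submodule (IwasawaAlgebra p) M))
        (primeT p) = 0 := by
    have hle : Module.lengthAt (IwasawaAlgebra p)
        ↥(Ideal.span {(PowerSeries.X : IwasawaAlgebra p)} • (⊤ : Submodule (IwasawaAlgebra p) M))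
          (primeT p) + Module.lengthAt (IwasawaAlgebra p) (coinvariants p M) (primeT p) ≤
        0 + Module.lengthAt (IwasawaAlgebra p) (coinvariants p M) (primeT p) := by
      rw [zero_add]
      calc _ = Module.lengthAt (IwasawaAlgebra p) M (primeT p) := hadd.symm
        _ = (coinvariantsRank p M : ℕ∞) := hℓM
        _ ≤ _ := hℓQ
    exact nonpos_iff_eq_zero.mp ((ENat.add_le_add_iff_right hQfin).mp hle)
  rw [Module.lengthAt_eq_zero_iff, LocalizedModule.subsingleton_iff] at h0
  have hmem : (PowerSeries.X : IwasawaAlgebra p) • m ∈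
      Ideal.span {(PowerSeries.X : IwasawaAlgebra p)} • (⊤ : Submodule (IwasawaAlgebra p) M) :=
    Submodule.smul_mem_smul (Ideal.subset_span rfl) Submodule.mem_top
  obtain ⟨u, hu, hum⟩ := h0 ⟨_, hmem⟩
  refine ⟨u, ?_, ?_⟩
  · rw [Ideal.mem_primeCompl_iff, h𝔭, mem_span_X_iff] at hu
    exact hu
  · have := congrArg Subtype.val hum
    simpa using this

/-- **Integral (SS) from the length equality**: `p^k T² x = 0 ⇒ p^{k'} T x = 0`.
[cite: GreenbergLNM1716, §1 p. 65 (after Conj. 1.12)] -/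
theorem padicBSDrank_pPow_semisimple_of_lengthAt_eq (p : ℕ) [Fact p.Prime]
    {M : Type u} [AddCommGroup M] [Module (IwasawaAlgebra p) M]
    [Module.Finite (IwasawaAlgebra p) M] (hM : Module.IsTorsion (IwasawaAlgebra p) M)
    (hℓM : Module.lengthAt (IwasawaAlgebra p) M (primeT p) = (coinvariantsRank p M : ℕ∞)) (x : M)
    (hx : ∃ k : ℕ, (PowerSeries.C ((p : ℤ_[p]) ^ k) * PowerSeries.X ^ 2 : IwasawaAlgebra p) • x = 0) :
    ∃ k : ℕ, (PowerSeries.C ((p : ℤ_[p]) ^ k) * PowerSeries.X : IwasawaAlgebra p) • x = 0 := by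
  obtain ⟨k, hk⟩ := hx
  obtain ⟨u, hu0, hu⟩ := padicBSDrank_exists_smul_X_smul_eq_zero_of_lengthAt_eq p hM hℓM x
  set y : M := (PowerSeries.X : IwasawaAlgebra p) • x with hy
  set z : M := (PowerSeries.C ((p : ℤ_[p]) ^ k) : IwasawaAlgebra p) • y with hz
  have hk' : (PowerSeries.C ((p : ℤ_[p]) ^ k) * PowerSeries.X : IwasawaAlgebra p) • y = 0 := by
    rw [hy, smul_smul, mul_assoc, ← pow_two]
    exact hk
  have hXz : (PowerSeries.X : IwasawaAlgebra p) • z = 0 := by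
    rw [hz, smul_smul, mul_comm, hk']
  have hC : (PowerSeries.C (PowerSeries.constantCoeff u) : IwasawaAlgebra p) • z = 0 := by
    rw [← smul_eq_C_smul_of_X_smul_eq_zero p u hXz, hz, smul_comm, hu, smul_zero]
  have key : (((PadicInt.unitCoeff hu0)⁻¹ : ℤ_[p]ˣ) : ℤ_[p]) * PowerSeries.constantCoeff u =
      (p : ℤ_[p]) ^ (PowerSeries.constantCoeff u).valuation :=
    (Units.inv_mul_eq_iff_eq_mul _).mpr (PadicInt.unitCoeff_spec hu0)
  refine ⟨k + (PowerSeries.constantCoeff u).valuation, ?_⟩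
  have hCeq : (PowerSeries.C ((p : ℤ_[p]) ^ (k + (PowerSeries.constantCoeff u).valuation)) :
      IwasawaAlgebra p) =
      PowerSeries.C (((PadicInt.unitCoeff hu0)⁻¹ : ℤ_[p]ˣ) : ℤ_[p]) *
        PowerSeries.C (PowerSeries.constantCoeff u) * PowerSeries.C ((p : ℤ_[p]) ^ k) := by
    rw [← map_mul, ← map_mul, pow_add, ← key]
    congr 1
    ring
  rw [mul_smul]
  change (PowerSeries.C ((p : ℤ_[p]) ^ (k + (PowerSeries.constantCoeff u).valuation)) :
    IwasawaAlgebra p) • y = 0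
  rw [hCeq, mul_smul, mul_smul]
  change (PowerSeries.C (((PadicInt.unitCoeff hu0)⁻¹ : ℤ_[p]ˣ) : ℤ_[p]) : IwasawaAlgebra p) •
    (PowerSeries.C (PowerSeries.constantCoeff u) : IwasawaAlgebra p) • z = 0
  rw [hC, smul_zero]

/-- **(SS) gives the length equality.** For a finitely generated torsion `Λ`-module `M` with
`ker T² = ker T` on `ℚ_p ⊗_{ℤ_p} M` (`mulTRat`): `ℓ_{(T)}(M) = rank_{ℤ_p} M/TM` in `ℕ∞`
(`(TM)_{(T)} = 0`, tree `lengthAt_eq_lengthAt_coinvariants`; `ℓ(M/TM) = rank_{ℤ_p} M/TM`, tree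
`lengthAt_eq_toENat_rank_of_X_smul_eq_zero`; finiteness from `lengthAt_primeT_ne_top`). This is the
generator-free core of `Greenberg1999_order_charGenerator_eq_coinvariantsRank_holds`.
[cite: GreenbergLNM1716, §1 p. 65 (after Conj. 1.12)] -/
theorem padicBSDrank_lengthAt_eq_coinvariantsRank_of_semisimple (p : ℕ) [Fact p.Prime]
    {M : Type u} [AddCommGroup M] [Module (IwasawaAlgebra p) M]
    [Module.Finite (IwasawaAlgebra p) M] (hM : Module.IsTorsion (IwasawaAlgebra p) M)
    (hss : LinearMap.ker (mulTRat p M ∘ₗ mulTRat p M) = LinearMap.ker (mulTRat p M)) :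
    Module.lengthAt (IwasawaAlgebra p) M (primeT p) = (coinvariantsRank p M : ℕ∞) := by
  have h𝔭 : (primeT p).asIdeal = Ideal.span {(PowerSeries.X : IwasawaAlgebra p)} := rfl
  have hfin : Module.lengthAt (IwasawaAlgebra p) M (primeT p) ≠ ⊤ := lengthAt_primeT_ne_top M hM
  have hMQ := lengthAt_eq_lengthAt_coinvariants p hM hss (primeT p) h𝔭
  -- `(ℓ(M/TM)).toNat = rank M/TM`
  letI : Module ℤ_[p] (coinvariants p M) :=
    Module.compHom _ (algebraMap ℤ_[p] (IwasawaAlgebra p))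
  haveI : IsScalarTower ℤ_[p] (IwasawaAlgebra p) (coinvariants p M) :=
    IsScalarTower.of_compHom ℤ_[p] _ _
  have hT : ∀ q : coinvariants p M, (PowerSeries.X : IwasawaAlgebra p) • q = 0 := by
    intro q
    induction q using Submodule.Quotient.induction_on with
    | H x => rw [← Submodule.Quotient.mk_smul]; exact coinvariants_mk_X_smul p M x
  have hQ : (Module.lengthAt (IwasawaAlgebra p) (coinvariants p M) (primeT p)).toNat =
      coinvariantsRank p M := by
    rw [lengthAt_eq_toENat_rank_of_X_smul_eq_zero p hT (primeT p) h𝔭, Cardinal.toNat_toENat,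
      coinvariantsRank_eq_finrank_int]
    rfl
  rw [← ENat.coe_toNat hfin, hMQ, hQ]

/-! ## The crux at a point: exactly three legs -/

/-- **The crux at a point is EXACTLY (MC_T) ∧ (SS) ∧ (Ш), modulo Kato's divisibility and Mazur
control at the point.** Let `E/ℚ` (globally minimal `W`), `p` prime, `f` a cusp form with `N ≠ 0`,
`κ` cyclotomic with topological generator `γ`, `D` a dual datum, `X = D.X`; assume (KD) `X` is
torsion and `g ∈ char_Λ X` with `ι g = p^n · L_p` for some `n ∈ ℕ` (Kato Thm 17.4 (1)–(2), the shape
of clauses 1–2 of the tree fact `kato_divisibility`), and (CT) `rank_{ℤ_p} X/TX = corank_{ℤ_p}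
Sel_{p^∞}(E/ℚ)`. Then `ord_{T=0} L_p = rank E(ℚ)` **iff** (MC_T) `ℓ_{(T)}(X) = ord_{T=0} L_p`
(exponent of `(T)` in `char X` = order of `L_p`) **and** (SS) `T` acts semisimply on `X` at `T = 0`
(integral spelling) **and** (Ш) `corank_{ℤ_p} Ш(E/ℚ)[p^∞] = 0`. The three legs are exactly the
three links of `corank = rank X/TX ≤ ℓ_{(T)}(X) ≤ ord_T L_p` and `rank ≤ corank`.
[cite: Kato2004Asterisque, Thm. 17.4 (p. 273)] [cite: GreenbergLNM1716, §1 Conj. 1.12–1.13 and p. 65] -/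
theorem padicBSDrank_eq_at_point_iff_three_legs
    (W : WeierstrassCurve ℚ) [W.IsElliptic] [W.IsGloballyMinimal] (p : ℕ) [Fact p.Prime]
    {N : ℕ} [NeZero N] (f : CuspForm (Gamma0 N) 2)
    {κ : ZpExtension ℚ p} {γ : Field.absoluteGaloisGroup ℚ} (hκ : κ.IsCyclotomic)
    (hγ : κ.IsTopGenerator γ) (D : W.SelmerDualData κ γ) (htors : D.IsTorsion)
    (hKD : ∃ (n : ℕ) (g : IwasawaAlgebra p), g ∈ D.charIdeal ∧
      iwasawaToPowerSeries p g =
        PowerSeries.C ((p : ℚ_[p]) ^ n) * padicLFunction f (unitRoot W p : ℚ_[p]))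
    (hctrl : coinvariantsRank p D.X = W.selmerCorank p) :
    (padicLFunction f (unitRoot W p : ℚ_[p])).order = W.mordellWeilRank ↔
      Module.lengthAt (IwasawaAlgebra p) D.X (primeT p) =
          (padicLFunction f (unitRoot W p : ℚ_[p])).order ∧
      (∀ x : D.X, (∃ k : ℕ, (PowerSeries.C ((p : ℤ_[p]) ^ k) * PowerSeries.X ^ 2 :
          IwasawaAlgebra p) • x = 0) →
        ∃ k : ℕ, (PowerSeries.C ((p : ℤ_[p]) ^ k) * PowerSeries.X : IwasawaAlgebra p) • x = 0) ∧
      W.shaCorank p = 0 := by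
  obtain ⟨n, g, hg, hι⟩ := hKD
  haveI : Module.Finite (IwasawaAlgebra p) D.X := D.module_finite_of_isCyclotomic W κ hκ hγ
  have hid := W.selmerCorank_eq_mordellWeilRank_add_holds p
  -- `ord_T g = ord_T L_p`
  have hpn : IsUnit (PowerSeries.C ((p : ℚ_[p]) ^ n)) := by
    refine IsUnit.map PowerSeries.C (IsUnit.pow n (IsUnit.mk0 _ ?_))
    exact_mod_cast (Fact.out : p.Prime).ne_zero
  have h2 : (iwasawaToPowerSeries p g).order = g.order :=
    bk_order_map_of_injective (algebraMap ℤ_[p] ℚ_[p]) (IsFractionRing.injective ℤ_[p] ℚ_[p]) g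
  have hordg : g.order = (padicLFunction f (unitRoot W p : ℚ_[p])).order := by
    rw [← h2, hι, PowerSeries.order_mul, PowerSeries.order_zero_of_unit hpn, zero_add]
  -- the chain `corank = rank X/TX ≤ ℓ_(T)(X) ≤ ord_T g = ord_T L_p`
  have hfin : Module.lengthAt (IwasawaAlgebra p) D.X (primeT p) ≠ ⊤ := lengthAt_primeT_ne_top D.X htors
  have hc1 : (coinvariantsRank p D.X : ℕ∞) ≤ Module.lengthAt (IwasawaAlgebra p) D.X (primeT p) :=
    coinvariantsRank_le_lengthAt_primeT D.X
  have hc2 : Module.lengthAt (IwasawaAlgebra p) D.X (primeT p) ≤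
      (padicLFunction f (unitRoot W p : ℚ_[p])).order := by
    rw [← hordg]
    exact lengthAt_primeT_le_order D.X htors g hg
  obtain ⟨ℓ, hℓ⟩ := ENat.ne_top_iff_exists.mp hfin
  rw [← hℓ] at hc1 hc2 ⊢
  have hc1' : coinvariantsRank p D.X ≤ ℓ := by exact_mod_cast hc1
  constructor
  · -- (⇒): all links are equalities
    intro hS
    rw [hS] at hc2 ⊢
    have hc2' : ℓ ≤ W.mordellWeilRank := by exact_mod_cast hc2
    have hℓeq : ℓ = coinvariantsRank p D.X := by omega
    refine ⟨by exact_mod_cast (show ℓ = W.mordellWeilRank by omega), fun x hx ↦ ?_, by omega⟩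
    exact padicBSDrank_pPow_semisimple_of_lengthAt_eq p htors (by rw [← hℓ, hℓeq]) x hx
  · -- (⇐): (MC_T) ∧ (SS) ∧ (Ш)
    rintro ⟨hMCT, hssInt, hsha⟩
    have hss := stub_ker_mulTRat_sq_eq p D.X hssInt
    have hℓc := padicBSDrank_lengthAt_eq_coinvariantsRank_of_semisimple p htors hss
    rw [← hℓ] at hℓc
    rw [← hMCT, hℓc, hctrl, hid, hsha, Nat.add_zero]

/-! ## Globally: the crux forces the main conjecture at `(T)` -/

/-- **The crux, with Kato's divisibility and Mazur control, implies the main conjecture at the prime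
`(T)`**: for every `E/ℚ` (globally minimal `W`), odd good ordinary `p`, newform `f` of `E`,
cyclotomic `κ` with topological generator `γ` matching the variable and dual datum `D`, the exponent
of `(T)` in `char_Λ X(E/ℚ_∞)` equals `ord_{T=0} L_p(E,T)`. Inputs: the crux `S`, the ∀-closure of the
tree fact `kato_divisibility` (Kato Thm 17.4, odd `p`, clauses 1–2), and
`Greenberg1999_coinvariantsRank_eq_selmerCorank_rat`. So (MC_T) — strictly weaker than item
stmt-15426 — is a NECESSARY input of the crux, like (SS) and (Ш).
[cite: Kato2004Asterisque, Thm. 17.4 (p. 273)] [cite: GreenbergLNM1716, §1 p. 65] -/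
theorem padicBSDrank_mainConjectureAtT_of_crux :
    Summit.BirchSwinnertonDyer.BirchSwinnertonDyer.Theses.PAdicOrderV2.PAdicOrderPadicBSDrankR2 →
    (∀ (W : WeierstrassCurve ℚ) [W.IsElliptic] [W.IsGloballyMinimal] (p : ℕ) [Fact p.Prime]
      (κ : Literature.NumberTheory.EllipticCurves.ZpExtension ℚ p) (γ : Field.absoluteGaloisGroup ℚ)
      {N : ℕ} [NeZero N] (f : CuspForm (CongruenceSubgroup.Gamma0 N) 2),
      Literature.NumberTheory.EllipticCurves.kato_divisibility W p (κ := κ) (γ := γ) (f := f)) →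
    Literature.NumberTheory.EllipticCurves.Greenberg1999_coinvariantsRank_eq_selmerCorank_rat →
    ∀ (W : WeierstrassCurve ℚ) [W.IsElliptic] [W.IsGloballyMinimal] (p : ℕ) [Fact p.Prime],
      p ≠ 2 → Literature.NumberTheory.EllipticCurves.IsOrdinaryAt W p →
      ∀ {N : ℕ} [NeZero N] (f : CuspForm (CongruenceSubgroup.Gamma0 N) 2),
      Literature.NumberTheory.EllipticCurves.ModularForms.IsNewformOf W f →
      ∀ (κ : Literature.NumberTheory.EllipticCurves.ZpExtension ℚ p) (γ : Field.absoluteGaloisGroup ℚ),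
      κ.IsCyclotomic → κ.IsTopGenerator γ →
      Literature.NumberTheory.EllipticCurves.IsCyclotomicVariable p γ →
      ∀ (D : W.SelmerDualData κ γ),
      Literature.NumberTheory.EllipticCurves.Module.lengthAt
          (Literature.NumberTheory.EllipticCurves.IwasawaAlgebra p) D.X
          (Literature.NumberTheory.EllipticCurves.IwasawaAlgebra.primeT p) =
        (Literature.NumberTheory.EllipticCurves.padicLFunction f
          (Literature.NumberTheory.EllipticCurves.unitRoot W p : ℚ_[p])).order := by
  intro hS hKD hCT W _ _ p _ hp2 hord N _ f hf κ γ hκ hγ hγ' D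
  obtain ⟨htors, hdiv, -⟩ := hKD W p κ γ f hp2 hord hκ hγ hγ' hf D
  have hctrl := (hCT W p hord.1 hord.2 κ γ hκ hγ D).2
  exact ((padicBSDrank_eq_at_point_iff_three_legs W p f hκ hγ D htors hdiv hctrl).mp
    (hS W p hord f hf)).1

end Summit.BirchSwinnertonDyer.BirchSwinnertonDyer.Theorems

end
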